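import Summits.QuantumFields.BalabanUV.Beta.GAN24.RowCChargeForms

/-!
# `BalabanUV.Beta.GAN24.RowCChargeFormsLegSym` — binder row G-an2-4 ∕ (CONV-C), W-slot EXIT (α-0), row (C): **THE EVEN MEMBER's (α-END) CHARGE INPUT `hC` AT `ε = 1`
# FROM THE LEG-SYMMETRISED (C)sym** — p2 g46's recipe (G7) (i)+(ii) (W-9 l.53690; WANTED by p2 g47 W-1 l.≈54060 for the capstone (G7)(iii) `WrecAtEvenHalfRowsOfQLCSymLeg`),
# so that the D1 literal's (C) binder can be weakened to a form that owes no off-diagonal residual charge (my R-leaf02-g64-1 ∕ `ResidualChargeLegAntisymm` p367725)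

NOT IN PRINT; OUR BOOKKEEPING (G-an2-4 crux team (2), leaf prover `b2b-balaban-gan24-formalise-leaf-02`, gen 64; journal OFFER O-leaf02-g64-2 l.53886, INTENT
I-leaf02-g64-7).  WHY.  The D1 END reads the W-slot table only through its EVEN half (`ALPHA0-STATUS` §0), and every capstone of record (`WrecAtEvenHalfRowsOfWardLetters`
PART D → p2's `…OfBorderLetters` → `…OfQLCSym`) consumes (C)sym `hS` through ONE term, leaf-01 g73's `RowCChargeForms.hC_halfMember_of_CSym_three … 1 hS` — the even
member's (α-END) charge input at `ε = 1`.  As typed, that term uses `hS` at the leg order `(κ₁,κ₂)` AND at `(κ₂,κ₁)` separately (`ZeroModeParity.zsym_halfTable`'s two zeros);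
in substance, at `ε = 1` only their SUM is needed (p2 W-9).  On the table-law route of the CONTACT side the residual charges are LEG-ANTISYMMETRIC (`ResidualChargeLegAntisymm`,
over p2 g44's `WardResidualParity`), so what the (C)_{≥1} programme can deliver is exactly the LEG-SYMMETRISED row; this file is the conversion that lets the literal consume
it: §1 the even half's `ZfreeSym` row from the leg-symmetrised row of any `LocStencil₂` table; §2 at `d = 3`, pin `cE₂ = Lc⁸`, the leg-symmetrised row (C) of record at
every level from the leg-symmetrised (C)sym (p2's IDENTITY `T2RecChargeStep.zmodeSym_sourceB_eq` at the pin — `T2RecChargeLedger.charge_factor_eq_one_of_pinEq` — at the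
two leg orders, the reference tower's charge being level-independent, leaf-01's `zsymMemberB_eq_zero_level_three`); §3 leaf-01's `RelSourceHalfCharge.zsym_relSource_half`
at `ε = 1` from the leg-symmetrised row, and the composition `hC_evenMember_of_CSymLeg_three` = `hC_halfMember_of_CSym_three`'s conclusion at `ε = 1` VERBATIM with `hS`
WEAKENED to the leg-symmetrised `hS₂`.

WHAT ([folklore] composition BY NAME over leaf-01 g73's `RowCChargeForms` (`zmode_pi_sub`, `zsymMemberB_eq_zero_level_three`), p2's `zmodeSym_sourceB_eq` ∕
`charge_factor_eq_one_of_pinEq`, the OWNER's `ZeroModeParity.zmode_sgnK_trK_inl_inl`, d1's `BiTableParityHalves.locStencil₂_sgnK_trK`, leaf-01's `RelSourceHalf.relSource_half_eq` ∕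
`RelSourceHalfCharge.locStencil₂_relSource`; 0 `def`, 0 cited facts, 0 `def … : Prop`, 0 sorry):
* §1 **`zsym_halfTable_legSym`** (`LocStencil₂ T C δ`, `0 < δ`, any `c`): `∀ κ κ′ κ₁ κ₂, [Z(κκ′;κ₁κ₂) + Z(κ′κ;κ₁κ₂)] + [Z(κκ′;κ₂κ₁) + Z(κ′κ;κ₂κ₁)] = 0` ⟹ the even half
  `c • (T + (1:ℝ) • P T)` obeys `Z(κκ′;κ₁κ₂) + Z(κ′κ;κ₁κ₂) = 0`.
* §2 **`rowCLegSym_of_CSymLeg_three`** (`d = 3`, `3 ≤ Lc`, pin `cE₂ = Lc⁸`, p2's border hypotheses): the leg-symmetrised (C)sym at every level ⟹ the leg-symmetrised row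
  (C) of record at every level.
* §3 **`zsym_relSource_even_of_rowCLegSym`** (generic `d`, in-block root) and **`hC_evenMember_of_CSymLeg_three`**.
HONEST FRAMING (cell contract, verbatim): «discharging `BetaPertH` makes Bałaban's UV stability UNCONDITIONAL — a real constructive-QFT result; it is NOT the continuum limit
and NOT the Clay problem.»  HONEST DEPENDENCY (verbatim): «continuum YM on T⁴ ⇐ BetaPertH ∧ nine spine estimates (0/9 proved); BetaPertH ⇐ (D1) ∧ (D4) ∧ CAP+tail; G-an2-4
gates asym, D1 and NE2/3/4.»  Asserts NO value of any charge; discharges NOTHING of (C) ∕ (C)sym ∕ (Q-L) ∕ «T2Shape» ∕ «T2Drift» ∕ (hW, hWall); NEVER «G-an2-4 closed» as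
(CONV-C); NOT D1, NOT BetaPertH, NOT continuum, NOT Clay.  2026-08-23.
-/

noncomputable section

open Finset
open scoped BigOperators
open Literature.MathematicalPhysics.QuantumFieldTheory
open Literature.MathematicalPhysics.QuantumFieldTheory.Balaban1983to89
open Literature.MathematicalPhysics.QuantumFieldTheory.Balaban1983to89.Beta
open ExpKernelCalculus (MKer Decays shiftK)
open OneStepResolventKernel (Fib)
open OneStepKernelFamily (KInvStep)
open SecondOrderResponse (W2SymOfK)
open BalabanStepJetsSucc (mmRead)
open BalabanStepW2 (K3OfK M2Of locStencil₂_smul')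
open AffineAveraging (box toSite)
open BalabanCompositeJets (LocStencil₂)
open AveragingMixedJetTables (mixFFAt)
open Summit.QuantumFields.BalabanUV.Beta.TameKernelCalculus (trK)
open Summit.QuantumFields.BalabanUV.Beta.BorderedHessian (sgnK)
open Summit.QuantumFields.BalabanUV.Beta.HessKerDressedUnits (unitK unitS)
open Summit.QuantumFields.BalabanUV.Beta.SecondOrderUnits (unitM unitS₂ unitM₂)
open Summit.QuantumFields.BalabanUV.Beta.AxialDressingRooted (coDressKBmAt)
open Summit.QuantumFields.BalabanUV.Beta.SpineRooted (T2RecOf T2RecAt SpureRecAt M1At)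
open Summit.QuantumFields.BalabanUV.Beta.GAN24.CombesThomas (sfStep smStep)
open Summit.QuantumFields.BalabanUV.Beta.GAN24.T2RecursionAffine (lin4)
open Summit.QuantumFields.BalabanUV.Beta.GAN24.BiStencilZeroMode (Tab zmode)
open Summit.QuantumFields.BalabanUV.Beta.GAN24.WSlotFirstDiff (zmode_add zmode_smul)
open Summit.QuantumFields.BalabanUV.Beta.GAN24.BiTableParityHalves (locStencil₂_sgnK_trK)
open Summit.QuantumFields.BalabanUV.Beta.GAN24.ZeroModeParity (zmode_sgnK_trK_inl_inl)
open Summit.QuantumFields.BalabanUV.Beta.GAN24.T2RecChargeStep (zmodeSym_sourceB_eq)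
open Summit.QuantumFields.BalabanUV.Beta.GAN24.T2RecChargeLedger (charge_factor_eq_one_of_pinEq)
open Summit.QuantumFields.BalabanUV.Beta.GAN24.RelSourceHalf (relSource_half_eq)
open Summit.QuantumFields.BalabanUV.Beta.GAN24.RelSourceHalfCharge (locStencil₂_relSource)
open Summit.QuantumFields.BalabanUV.Beta.GAN24.RowCChargeForms (zmode_pi_sub zsymMemberB_eq_zero_level_three)

namespace Summit.QuantumFields.BalabanUV.Beta.GAN24.RowCChargeFormsLegSym

variable {d : ℕ} {N : ℕ} {Lc : ℕ} [NeZero Lc] {r : Fin (d + 1) → ℕ}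

/-! ## §1 The even half's `ZfreeSym` row from the leg-symmetrised row -/

/-- NOT IN PRINT; OUR BOOKKEEPING.  **(G7)(i): THE EVEN HALF's `ZfreeSym` ROW FROM THE LEG-SYMMETRISED ROW** (`LocStencil₂` at a positive rate; any `c`): if the
bond-symmetrised ff charges of `T` vanish AFTER SYMMETRISATION IN THE TWO LEG FIBRES, the even half `c • (T + 1 • P T)`, `P = sgnK ∘ trK`, obeys the full row
(the parity image swaps the leg fibres: `ZeroModeParity.zmode_sgnK_trK_inl_inl`). -/
theorem zsym_halfTable_legSym {T : Tab d} {C δ : ℝ} (hT : LocStencil₂ T C δ) (hδ : 0 < δ)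
    (hZ2 : ∀ κ κ' κ₁ κ₂, (zmode N T κ κ' (Sum.inl κ₁) (Sum.inl κ₂) + zmode N T κ' κ (Sum.inl κ₁) (Sum.inl κ₂))
      + (zmode N T κ κ' (Sum.inl κ₂) (Sum.inl κ₁) + zmode N T κ' κ (Sum.inl κ₂) (Sum.inl κ₁)) = 0) (c : ℝ) (κ κ' κ₁ κ₂ : Fin (d + 1)) :
    zmode N (c • (T + (1 : ℝ) • fun κ u κ' u' => sgnK (trK (T κ u κ' u')))) κ κ' (Sum.inl κ₁) (Sum.inl κ₂) +
      zmode N (c • (T + (1 : ℝ) • fun κ u κ' u' => sgnK (trK (T κ u κ' u')))) κ' κ (Sum.inl κ₁) (Sum.inl κ₂) = 0 := by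
  have hP : LocStencil₂ (fun κ u κ' u' => sgnK (trK (T κ u κ' u'))) C δ := locStencil₂_sgnK_trK hT
  have e : (c • (T + (1 : ℝ) • fun κ u κ' u' => sgnK (trK (T κ u κ' u')))) = fun κ u κ' u' => c • (T κ u κ' u' + sgnK (trK (T κ u κ' u'))) := by
    rw [one_smul]; rfl
  rw [e, zmode_smul, zmode_smul, zmode_add hT hP hδ, zmode_add hT hP hδ, zmode_sgnK_trK_inl_inl hT hδ, zmode_sgnK_trK_inl_inl hT hδ]
  have h := hZ2 κ κ' κ₁ κ₂
  have : c * (zmode N T κ κ' (Sum.inl κ₁) (Sum.inl κ₂) + zmode N T κ κ' (Sum.inl κ₂) (Sum.inl κ₁)) +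
      c * (zmode N T κ' κ (Sum.inl κ₁) (Sum.inl κ₂) + zmode N T κ' κ (Sum.inl κ₂) (Sum.inl κ₁))
      = c * ((zmode N T κ κ' (Sum.inl κ₁) (Sum.inl κ₂) + zmode N T κ' κ (Sum.inl κ₁) (Sum.inl κ₂))
        + (zmode N T κ κ' (Sum.inl κ₂) (Sum.inl κ₁) + zmode N T κ' κ (Sum.inl κ₂) (Sum.inl κ₁))) := by ring
  rw [this, h, mul_zero]

/-! ## §2 The leg-symmetrised row (C) of record from the leg-symmetrised (C)sym (`d = 3`, pin `cE₂ = Lc⁸`) -/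

/-- NOT IN PRINT; OUR BOOKKEEPING.  **(G7)(ii-a)**: at `d = 3`, `3 ≤ Lc`, pin `cE₂ = Lc⁸`, the LEG-SYMMETRISED (C)sym at every level (the dressed comb tower's
bond-symmetrised ff charge, summed over the two leg orders, equals the reference tower's) gives the LEG-SYMMETRISED row (C) of record at every level — p2's identity
`zmodeSym_sourceB_eq` at the pin (`charge_factor_eq_one_of_pinEq`) summed over the two leg orders, the reference tower's charge being level-independent
(`zsymMemberB_eq_zero_level_three`). -/
theorem rowCLegSym_of_CSymLeg_three (hLc : 3 ≤ Lc) {r : Fin (3 + 1) → ℕ} (hr : r ∈ box (3 + 1) Lc) (cE cVH cΛ cE₂ cB : ℝ) (Tc : Fin 4 → Fin 4 → Fin 4 → Fin 4 → ℝ)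
    {vh₂S : Tab 3} (hBff : ∀ κ u κ' u' x z (α β : Fin (3 + 1)), vh₂S κ u κ' u' x z (Sum.inl α) (Sum.inl β) = 0)
    (hBmm : ∀ κ u κ' u' x z (μ ν : Fin (3 + 1)), vh₂S κ u κ' u' x z (Sum.inr μ) (Sum.inr ν) = 0)
    {CB δB : ℝ} (hB : LocStencil₂ vh₂S CB δB) (hδB : 0 < δB)
    (hBt : ∀ (κ : Fin (3 + 1)) (u : Fin (3 + 1) → ℤ) (κ' : Fin (3 + 1)) (u' t : Fin (3 + 1) → ℤ),
      vh₂S κ (u + (Lc : ℤ) • t) κ' (u' + (Lc : ℤ) • t) = shiftK (-((Lc : ℤ) • t)) (vh₂S κ u κ' u'))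
    (hcE₂ : cE₂ = (Lc : ℝ) ^ 8)
    (hS₂ : ∀ (i : ℕ) (κ κ' κ₁ κ₂ : Fin (3 + 1)),
      (zmode Lc (unitS₂ (sfStep Lc i) (smStep 3 Lc i) (T2RecAt 3 Lc (toSite r) cE cVH cΛ cE₂ cB Tc vh₂S (mixFFAt (toSite r) Lc) i)) κ κ' (Sum.inl κ₁) (Sum.inl κ₂)
        + zmode Lc (unitS₂ (sfStep Lc i) (smStep 3 Lc i) (T2RecAt 3 Lc (toSite r) cE cVH cΛ cE₂ cB Tc vh₂S (mixFFAt (toSite r) Lc) i)) κ' κ (Sum.inl κ₁) (Sum.inl κ₂))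
        + (zmode Lc (unitS₂ (sfStep Lc i) (smStep 3 Lc i) (T2RecAt 3 Lc (toSite r) cE cVH cΛ cE₂ cB Tc vh₂S (mixFFAt (toSite r) Lc) i)) κ κ' (Sum.inl κ₂) (Sum.inl κ₁)
        + zmode Lc (unitS₂ (sfStep Lc i) (smStep 3 Lc i) (T2RecAt 3 Lc (toSite r) cE cVH cΛ cE₂ cB Tc vh₂S (mixFFAt (toSite r) Lc) i)) κ' κ (Sum.inl κ₂) (Sum.inl κ₁))
      = (zmode Lc (unitS₂ (sfStep Lc i) (smStep 3 Lc i) (T2RecOf 3 Lc (fun j => KInvStep (d := 3) Lc j) (SpureRecAt 3 Lc (toSite r) cE cVH cΛ) (M1At 3 Lc (toSite r) cΛ) cE₂ cB Tc vh₂S (mixFFAt (toSite r) Lc) i)) κ κ' (Sum.inl κ₁) (Sum.inl κ₂)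
        + zmode Lc (unitS₂ (sfStep Lc i) (smStep 3 Lc i) (T2RecOf 3 Lc (fun j => KInvStep (d := 3) Lc j) (SpureRecAt 3 Lc (toSite r) cE cVH cΛ) (M1At 3 Lc (toSite r) cΛ) cE₂ cB Tc vh₂S (mixFFAt (toSite r) Lc) i)) κ' κ (Sum.inl κ₁) (Sum.inl κ₂))
        + (zmode Lc (unitS₂ (sfStep Lc i) (smStep 3 Lc i) (T2RecOf 3 Lc (fun j => KInvStep (d := 3) Lc j) (SpureRecAt 3 Lc (toSite r) cE cVH cΛ) (M1At 3 Lc (toSite r) cΛ) cE₂ cB Tc vh₂S (mixFFAt (toSite r) Lc) i)) κ κ' (Sum.inl κ₂) (Sum.inl κ₁)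
        + zmode Lc (unitS₂ (sfStep Lc i) (smStep 3 Lc i) (T2RecOf 3 Lc (fun j => KInvStep (d := 3) Lc j) (SpureRecAt 3 Lc (toSite r) cE cVH cΛ) (M1At 3 Lc (toSite r) cΛ) cE₂ cB Tc vh₂S (mixFFAt (toSite r) Lc) i)) κ' κ (Sum.inl κ₂) (Sum.inl κ₁)))
    (l : ℕ) (κ κ' κ₁ κ₂ : Fin (3 + 1)) :
    (zmode Lc ((unitS₂ (sfStep Lc (l + 1)) (smStep 3 Lc (l + 1)) (T2RecAt 3 Lc (toSite r) cE cVH cΛ cE₂ cB Tc vh₂S (mixFFAt (toSite r) Lc) (l + 1))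
            - lin4 (cE₂ * (Lc : ℝ) ^ (2 * (3 + 1))) (unitK (sfStep Lc l) (smStep 3 Lc l) (KInvStep (d := 3) Lc l)) Lc
              (unitS₂ (sfStep Lc l) (smStep 3 Lc l) (T2RecAt 3 Lc (toSite r) cE cVH cΛ cE₂ cB Tc vh₂S (mixFFAt (toSite r) Lc) l)))) κ κ' (Sum.inl κ₁) (Sum.inl κ₂)
        + zmode Lc ((unitS₂ (sfStep Lc (l + 1)) (smStep 3 Lc (l + 1)) (T2RecAt 3 Lc (toSite r) cE cVH cΛ cE₂ cB Tc vh₂S (mixFFAt (toSite r) Lc) (l + 1))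
            - lin4 (cE₂ * (Lc : ℝ) ^ (2 * (3 + 1))) (unitK (sfStep Lc l) (smStep 3 Lc l) (KInvStep (d := 3) Lc l)) Lc
              (unitS₂ (sfStep Lc l) (smStep 3 Lc l) (T2RecAt 3 Lc (toSite r) cE cVH cΛ cE₂ cB Tc vh₂S (mixFFAt (toSite r) Lc) l)))) κ' κ (Sum.inl κ₁) (Sum.inl κ₂))
      + (zmode Lc ((unitS₂ (sfStep Lc (l + 1)) (smStep 3 Lc (l + 1)) (T2RecAt 3 Lc (toSite r) cE cVH cΛ cE₂ cB Tc vh₂S (mixFFAt (toSite r) Lc) (l + 1))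
            - lin4 (cE₂ * (Lc : ℝ) ^ (2 * (3 + 1))) (unitK (sfStep Lc l) (smStep 3 Lc l) (KInvStep (d := 3) Lc l)) Lc
              (unitS₂ (sfStep Lc l) (smStep 3 Lc l) (T2RecAt 3 Lc (toSite r) cE cVH cΛ cE₂ cB Tc vh₂S (mixFFAt (toSite r) Lc) l)))) κ κ' (Sum.inl κ₂) (Sum.inl κ₁)
        + zmode Lc ((unitS₂ (sfStep Lc (l + 1)) (smStep 3 Lc (l + 1)) (T2RecAt 3 Lc (toSite r) cE cVH cΛ cE₂ cB Tc vh₂S (mixFFAt (toSite r) Lc) (l + 1))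
            - lin4 (cE₂ * (Lc : ℝ) ^ (2 * (3 + 1))) (unitK (sfStep Lc l) (smStep 3 Lc l) (KInvStep (d := 3) Lc l)) Lc
              (unitS₂ (sfStep Lc l) (smStep 3 Lc l) (T2RecAt 3 Lc (toSite r) cE cVH cΛ cE₂ cB Tc vh₂S (mixFFAt (toSite r) Lc) l)))) κ' κ (Sum.inl κ₂) (Sum.inl κ₁)) = 0 := by
  have hLc1 : 1 ≤ Lc := le_trans (by norm_num) hLc
  have hpin : cE₂ = (Lc : ℝ) ^ (3 + 5) := hcE₂.trans (by norm_num)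
  have e1 := zmodeSym_sourceB_eq (d := 3) hLc1 hr cE cVH cΛ cE₂ cB Tc ⟨CB, δB, hδB, hB⟩ hBt Lc l κ κ' κ₁ κ₂
  have e2 := zmodeSym_sourceB_eq (d := 3) hLc1 hr cE cVH cΛ cE₂ cB Tc ⟨CB, δB, hδB, hB⟩ hBt Lc l κ κ' κ₂ κ₁
  rw [charge_factor_eq_one_of_pinEq (d := 3) (Lc := Lc) hpin, one_mul] at e1 e2
  have r1 := zsymMemberB_eq_zero_level_three hLc hr cE cVH cΛ cE₂ cB Tc hBff hBmm hB hδB hBt hcE₂ (l + 1) κ κ' κ₁ κ₂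
  have r1' := zsymMemberB_eq_zero_level_three hLc hr cE cVH cΛ cE₂ cB Tc hBff hBmm hB hδB hBt hcE₂ (l + 1) κ κ' κ₂ κ₁
  have r0 := zsymMemberB_eq_zero_level_three hLc hr cE cVH cΛ cE₂ cB Tc hBff hBmm hB hδB hBt hcE₂ l κ κ' κ₁ κ₂
  have r0' := zsymMemberB_eq_zero_level_three hLc hr cE cVH cΛ cE₂ cB Tc hBff hBmm hB hδB hBt hcE₂ l κ κ' κ₂ κ₁
  have h1 := hS₂ (l + 1) κ κ' κ₁ κ₂
  have h0 := hS₂ l κ κ' κ₁ κ₂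
  rw [zmode_pi_sub, zmode_pi_sub, zmode_pi_sub, zmode_pi_sub, e1, e2]
  linarith

/-! ## §3 The even member's (α-END) charge input at `ε = 1` -/

/-- NOT IN PRINT; OUR BOOKKEEPING.  **leaf-01's `zsym_relSource_half` AT `ε = 1` FROM THE LEG-SYMMETRISED ROW** (generic `d`, in-block root; `relSource_half_eq` ⨾ §1). -/
theorem zsym_relSource_even_of_rowCLegSym (hLc : 1 ≤ Lc) (hr : r ∈ box (d + 1) Lc) (cE cVH cΛ cE₂ cB : ℝ) (Tc : Fin 4 → Fin 4 → Fin 4 → Fin 4 → ℝ)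
    {vh₂S : Tab d} (hBff : ∀ κ u κ' u' x z (α β : Fin (d + 1)), vh₂S κ u κ' u' x z (Sum.inl α) (Sum.inl β) = 0)
    (hBmm : ∀ κ u κ' u' x z (μ ν : Fin (d + 1)), vh₂S κ u κ' u' x z (Sum.inr μ) (Sum.inr ν) = 0)
    (hB : ∃ C δ : ℝ, 0 < δ ∧ LocStencil₂ vh₂S C δ)
    (hC2 : ∀ (l : ℕ) (κ κ' κ₁ κ₂ : Fin (d + 1)),
      (zmode Lc ((unitS₂ (sfStep Lc (l + 1)) (smStep d Lc (l + 1)) (T2RecAt d Lc (toSite r) cE cVH cΛ cE₂ cB Tc vh₂S (mixFFAt (toSite r) Lc) (l + 1))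
            - lin4 (cE₂ * (Lc : ℝ) ^ (2 * (d + 1))) (unitK (sfStep Lc l) (smStep d Lc l) (KInvStep (d := d) Lc l)) Lc
              (unitS₂ (sfStep Lc l) (smStep d Lc l) (T2RecAt d Lc (toSite r) cE cVH cΛ cE₂ cB Tc vh₂S (mixFFAt (toSite r) Lc) l)))) κ κ' (Sum.inl κ₁) (Sum.inl κ₂)
        + zmode Lc ((unitS₂ (sfStep Lc (l + 1)) (smStep d Lc (l + 1)) (T2RecAt d Lc (toSite r) cE cVH cΛ cE₂ cB Tc vh₂S (mixFFAt (toSite r) Lc) (l + 1))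
            - lin4 (cE₂ * (Lc : ℝ) ^ (2 * (d + 1))) (unitK (sfStep Lc l) (smStep d Lc l) (KInvStep (d := d) Lc l)) Lc
              (unitS₂ (sfStep Lc l) (smStep d Lc l) (T2RecAt d Lc (toSite r) cE cVH cΛ cE₂ cB Tc vh₂S (mixFFAt (toSite r) Lc) l)))) κ' κ (Sum.inl κ₁) (Sum.inl κ₂))
        + (zmode Lc ((unitS₂ (sfStep Lc (l + 1)) (smStep d Lc (l + 1)) (T2RecAt d Lc (toSite r) cE cVH cΛ cE₂ cB Tc vh₂S (mixFFAt (toSite r) Lc) (l + 1))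
            - lin4 (cE₂ * (Lc : ℝ) ^ (2 * (d + 1))) (unitK (sfStep Lc l) (smStep d Lc l) (KInvStep (d := d) Lc l)) Lc
              (unitS₂ (sfStep Lc l) (smStep d Lc l) (T2RecAt d Lc (toSite r) cE cVH cΛ cE₂ cB Tc vh₂S (mixFFAt (toSite r) Lc) l)))) κ κ' (Sum.inl κ₂) (Sum.inl κ₁)
        + zmode Lc ((unitS₂ (sfStep Lc (l + 1)) (smStep d Lc (l + 1)) (T2RecAt d Lc (toSite r) cE cVH cΛ cE₂ cB Tc vh₂S (mixFFAt (toSite r) Lc) (l + 1))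
            - lin4 (cE₂ * (Lc : ℝ) ^ (2 * (d + 1))) (unitK (sfStep Lc l) (smStep d Lc l) (KInvStep (d := d) Lc l)) Lc
              (unitS₂ (sfStep Lc l) (smStep d Lc l) (T2RecAt d Lc (toSite r) cE cVH cΛ cE₂ cB Tc vh₂S (mixFFAt (toSite r) Lc) l)))) κ' κ (Sum.inl κ₂) (Sum.inl κ₁)) = 0)
    (l : ℕ) (κ κ' κ₁ κ₂ : Fin (d + 1)) :
    zmode Lc (((1 / 2 : ℝ) • ((fun κ u κ' u' => (cE₂ * (Lc : ℝ) ^ (2 * (d + 1))) • mmRead Lc (K3OfK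
            (unitK (sfStep Lc l) (smStep d Lc l) (coDressKBmAt (toSite r) Lc (KInvStep (d := d) Lc l))) Lc
            (unitS (sfStep Lc l) (smStep d Lc l) (SpureRecAt d Lc (toSite r) cE cVH cΛ l)) (unitM (sfStep Lc l) (smStep d Lc l) (M1At d Lc (toSite r) cΛ l))
            (W2SymOfK (unitK (sfStep Lc l) (smStep d Lc l) (coDressKBmAt (toSite r) Lc (KInvStep (d := d) Lc l))) Lc
              (unitS (sfStep Lc l) (smStep d Lc l) (SpureRecAt d Lc (toSite r) cE cVH cΛ l)) (unitM (sfStep Lc l) (smStep d Lc l) (M1At d Lc (toSite r) cΛ l)) 0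
              (unitM₂ (sfStep Lc l) (smStep d Lc l) (M2Of d Lc (mixFFAt (toSite r) Lc) l))) κ u κ' u') + cB • vh₂S κ u κ' u')
          + (1 : ℝ) • fun κ u κ' u' => sgnK (trK ((fun κ u κ' u' => (cE₂ * (Lc : ℝ) ^ (2 * (d + 1))) • mmRead Lc (K3OfK
            (unitK (sfStep Lc l) (smStep d Lc l) (coDressKBmAt (toSite r) Lc (KInvStep (d := d) Lc l))) Lc
            (unitS (sfStep Lc l) (smStep d Lc l) (SpureRecAt d Lc (toSite r) cE cVH cΛ l)) (unitM (sfStep Lc l) (smStep d Lc l) (M1At d Lc (toSite r) cΛ l))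
            (W2SymOfK (unitK (sfStep Lc l) (smStep d Lc l) (coDressKBmAt (toSite r) Lc (KInvStep (d := d) Lc l))) Lc
              (unitS (sfStep Lc l) (smStep d Lc l) (SpureRecAt d Lc (toSite r) cE cVH cΛ l)) (unitM (sfStep Lc l) (smStep d Lc l) (M1At d Lc (toSite r) cΛ l)) 0
              (unitM₂ (sfStep Lc l) (smStep d Lc l) (M2Of d Lc (mixFFAt (toSite r) Lc) l))) κ u κ' u') + cB • vh₂S κ u κ' u') κ u κ' u'))))
        + (lin4 (cE₂ * (Lc : ℝ) ^ (2 * (d + 1))) (unitK (sfStep Lc l) (smStep d Lc l) (coDressKBmAt (toSite r) Lc (KInvStep (d := d) Lc l))) Lc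
              ((1 / 2 : ℝ) • (unitS₂ (sfStep Lc l) (smStep d Lc l) (T2RecAt d Lc (toSite r) cE cVH cΛ cE₂ cB Tc vh₂S (mixFFAt (toSite r) Lc) l)
          + (1 : ℝ) • fun κ u κ' u' => sgnK (trK (unitS₂ (sfStep Lc l) (smStep d Lc l) (T2RecAt d Lc (toSite r) cE cVH cΛ cE₂ cB Tc vh₂S (mixFFAt (toSite r) Lc) l) κ u κ' u'))))
          - lin4 (cE₂ * (Lc : ℝ) ^ (2 * (d + 1))) (unitK (sfStep Lc l) (smStep d Lc l) (KInvStep (d := d) Lc l)) Lc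
              ((1 / 2 : ℝ) • (unitS₂ (sfStep Lc l) (smStep d Lc l) (T2RecAt d Lc (toSite r) cE cVH cΛ cE₂ cB Tc vh₂S (mixFFAt (toSite r) Lc) l)
          + (1 : ℝ) • fun κ u κ' u' => sgnK (trK (unitS₂ (sfStep Lc l) (smStep d Lc l) (T2RecAt d Lc (toSite r) cE cVH cΛ cE₂ cB Tc vh₂S (mixFFAt (toSite r) Lc) l) κ u κ' u')))))) κ κ' (Sum.inl κ₁) (Sum.inl κ₂)
      + zmode Lc (((1 / 2 : ℝ) • ((fun κ u κ' u' => (cE₂ * (Lc : ℝ) ^ (2 * (d + 1))) • mmRead Lc (K3OfK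
            (unitK (sfStep Lc l) (smStep d Lc l) (coDressKBmAt (toSite r) Lc (KInvStep (d := d) Lc l))) Lc
            (unitS (sfStep Lc l) (smStep d Lc l) (SpureRecAt d Lc (toSite r) cE cVH cΛ l)) (unitM (sfStep Lc l) (smStep d Lc l) (M1At d Lc (toSite r) cΛ l))
            (W2SymOfK (unitK (sfStep Lc l) (smStep d Lc l) (coDressKBmAt (toSite r) Lc (KInvStep (d := d) Lc l))) Lc
              (unitS (sfStep Lc l) (smStep d Lc l) (SpureRecAt d Lc (toSite r) cE cVH cΛ l)) (unitM (sfStep Lc l) (smStep d Lc l) (M1At d Lc (toSite r) cΛ l)) 0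
              (unitM₂ (sfStep Lc l) (smStep d Lc l) (M2Of d Lc (mixFFAt (toSite r) Lc) l))) κ u κ' u') + cB • vh₂S κ u κ' u')
          + (1 : ℝ) • fun κ u κ' u' => sgnK (trK ((fun κ u κ' u' => (cE₂ * (Lc : ℝ) ^ (2 * (d + 1))) • mmRead Lc (K3OfK
            (unitK (sfStep Lc l) (smStep d Lc l) (coDressKBmAt (toSite r) Lc (KInvStep (d := d) Lc l))) Lc
            (unitS (sfStep Lc l) (smStep d Lc l) (SpureRecAt d Lc (toSite r) cE cVH cΛ l)) (unitM (sfStep Lc l) (smStep d Lc l) (M1At d Lc (toSite r) cΛ l))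
            (W2SymOfK (unitK (sfStep Lc l) (smStep d Lc l) (coDressKBmAt (toSite r) Lc (KInvStep (d := d) Lc l))) Lc
              (unitS (sfStep Lc l) (smStep d Lc l) (SpureRecAt d Lc (toSite r) cE cVH cΛ l)) (unitM (sfStep Lc l) (smStep d Lc l) (M1At d Lc (toSite r) cΛ l)) 0
              (unitM₂ (sfStep Lc l) (smStep d Lc l) (M2Of d Lc (mixFFAt (toSite r) Lc) l))) κ u κ' u') + cB • vh₂S κ u κ' u') κ u κ' u'))))
        + (lin4 (cE₂ * (Lc : ℝ) ^ (2 * (d + 1))) (unitK (sfStep Lc l) (smStep d Lc l) (coDressKBmAt (toSite r) Lc (KInvStep (d := d) Lc l))) Lc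
              ((1 / 2 : ℝ) • (unitS₂ (sfStep Lc l) (smStep d Lc l) (T2RecAt d Lc (toSite r) cE cVH cΛ cE₂ cB Tc vh₂S (mixFFAt (toSite r) Lc) l)
          + (1 : ℝ) • fun κ u κ' u' => sgnK (trK (unitS₂ (sfStep Lc l) (smStep d Lc l) (T2RecAt d Lc (toSite r) cE cVH cΛ cE₂ cB Tc vh₂S (mixFFAt (toSite r) Lc) l) κ u κ' u'))))
          - lin4 (cE₂ * (Lc : ℝ) ^ (2 * (d + 1))) (unitK (sfStep Lc l) (smStep d Lc l) (KInvStep (d := d) Lc l)) Lc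
              ((1 / 2 : ℝ) • (unitS₂ (sfStep Lc l) (smStep d Lc l) (T2RecAt d Lc (toSite r) cE cVH cΛ cE₂ cB Tc vh₂S (mixFFAt (toSite r) Lc) l)
          + (1 : ℝ) • fun κ u κ' u' => sgnK (trK (unitS₂ (sfStep Lc l) (smStep d Lc l) (T2RecAt d Lc (toSite r) cE cVH cΛ cE₂ cB Tc vh₂S (mixFFAt (toSite r) Lc) l) κ u κ' u')))))) κ' κ (Sum.inl κ₁) (Sum.inl κ₂) = 0 := by
  obtain ⟨C, δ, hδ, hrel⟩ := locStencil₂_relSource hLc hr cE cVH cΛ cE₂ cB Tc hB l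
  rw [relSource_half_eq hLc hr cE cVH cΛ cE₂ cB Tc hBff hBmm hB 1 l]
  exact zsym_halfTable_legSym hrel hδ (hC2 l) (1 / 2 : ℝ) κ κ' κ₁ κ₂

/-- NOT IN PRINT; OUR BOOKKEEPING.  **(G7)(ii-b): `hC_halfMember_of_CSym_three` AT `ε = 1` WITH `hS` WEAKENED TO THE LEG-SYMMETRISED `hS₂`** — the (α-END)'s displayed
`hC` for the EVEN member (the only value the D1 END reads, `WrecAtEvenHalfRowsOfQLCSym` passes `ε := 1`) from «the dressed and the reference comb towers have the same
bond-symmetrised ff charge after symmetrisation in the two leg fibres, at every level» (§2 ⨾ §3). -/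
theorem hC_evenMember_of_CSymLeg_three (hLc : 3 ≤ Lc) {r : Fin (3 + 1) → ℕ} (hr : r ∈ box (3 + 1) Lc) (cE cVH cΛ cE₂ cB : ℝ) (Tc : Fin 4 → Fin 4 → Fin 4 → Fin 4 → ℝ)
    {vh₂S : Tab 3} (hBff : ∀ κ u κ' u' x z (α β : Fin (3 + 1)), vh₂S κ u κ' u' x z (Sum.inl α) (Sum.inl β) = 0)
    (hBmm : ∀ κ u κ' u' x z (μ ν : Fin (3 + 1)), vh₂S κ u κ' u' x z (Sum.inr μ) (Sum.inr ν) = 0)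
    {CB δB : ℝ} (hB : LocStencil₂ vh₂S CB δB) (hδB : 0 < δB)
    (hBt : ∀ (κ : Fin (3 + 1)) (u : Fin (3 + 1) → ℤ) (κ' : Fin (3 + 1)) (u' t : Fin (3 + 1) → ℤ),
      vh₂S κ (u + (Lc : ℤ) • t) κ' (u' + (Lc : ℤ) • t) = shiftK (-((Lc : ℤ) • t)) (vh₂S κ u κ' u'))
    (hcE₂ : cE₂ = (Lc : ℝ) ^ 8)
    (hS₂ : ∀ (i : ℕ) (κ κ' κ₁ κ₂ : Fin (3 + 1)),
      (zmode Lc (unitS₂ (sfStep Lc i) (smStep 3 Lc i) (T2RecAt 3 Lc (toSite r) cE cVH cΛ cE₂ cB Tc vh₂S (mixFFAt (toSite r) Lc) i)) κ κ' (Sum.inl κ₁) (Sum.inl κ₂)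
        + zmode Lc (unitS₂ (sfStep Lc i) (smStep 3 Lc i) (T2RecAt 3 Lc (toSite r) cE cVH cΛ cE₂ cB Tc vh₂S (mixFFAt (toSite r) Lc) i)) κ' κ (Sum.inl κ₁) (Sum.inl κ₂))
        + (zmode Lc (unitS₂ (sfStep Lc i) (smStep 3 Lc i) (T2RecAt 3 Lc (toSite r) cE cVH cΛ cE₂ cB Tc vh₂S (mixFFAt (toSite r) Lc) i)) κ κ' (Sum.inl κ₂) (Sum.inl κ₁)
        + zmode Lc (unitS₂ (sfStep Lc i) (smStep 3 Lc i) (T2RecAt 3 Lc (toSite r) cE cVH cΛ cE₂ cB Tc vh₂S (mixFFAt (toSite r) Lc) i)) κ' κ (Sum.inl κ₂) (Sum.inl κ₁))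
      = (zmode Lc (unitS₂ (sfStep Lc i) (smStep 3 Lc i) (T2RecOf 3 Lc (fun j => KInvStep (d := 3) Lc j) (SpureRecAt 3 Lc (toSite r) cE cVH cΛ) (M1At 3 Lc (toSite r) cΛ) cE₂ cB Tc vh₂S (mixFFAt (toSite r) Lc) i)) κ κ' (Sum.inl κ₁) (Sum.inl κ₂)
        + zmode Lc (unitS₂ (sfStep Lc i) (smStep 3 Lc i) (T2RecOf 3 Lc (fun j => KInvStep (d := 3) Lc j) (SpureRecAt 3 Lc (toSite r) cE cVH cΛ) (M1At 3 Lc (toSite r) cΛ) cE₂ cB Tc vh₂S (mixFFAt (toSite r) Lc) i)) κ' κ (Sum.inl κ₁) (Sum.inl κ₂))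
        + (zmode Lc (unitS₂ (sfStep Lc i) (smStep 3 Lc i) (T2RecOf 3 Lc (fun j => KInvStep (d := 3) Lc j) (SpureRecAt 3 Lc (toSite r) cE cVH cΛ) (M1At 3 Lc (toSite r) cΛ) cE₂ cB Tc vh₂S (mixFFAt (toSite r) Lc) i)) κ κ' (Sum.inl κ₂) (Sum.inl κ₁)
        + zmode Lc (unitS₂ (sfStep Lc i) (smStep 3 Lc i) (T2RecOf 3 Lc (fun j => KInvStep (d := 3) Lc j) (SpureRecAt 3 Lc (toSite r) cE cVH cΛ) (M1At 3 Lc (toSite r) cΛ) cE₂ cB Tc vh₂S (mixFFAt (toSite r) Lc) i)) κ' κ (Sum.inl κ₂) (Sum.inl κ₁)))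
    (l : ℕ) (κ κ' κ₁ κ₂ : Fin (3 + 1)) :
    zmode Lc (((1 / 2 : ℝ) • ((fun κ u κ' u' => (cE₂ * (Lc : ℝ) ^ (2 * (3 + 1))) • mmRead Lc (K3OfK
            (unitK (sfStep Lc l) (smStep 3 Lc l) (coDressKBmAt (toSite r) Lc (KInvStep (d := 3) Lc l))) Lc
            (unitS (sfStep Lc l) (smStep 3 Lc l) (SpureRecAt 3 Lc (toSite r) cE cVH cΛ l)) (unitM (sfStep Lc l) (smStep 3 Lc l) (M1At 3 Lc (toSite r) cΛ l))
            (W2SymOfK (unitK (sfStep Lc l) (smStep 3 Lc l) (coDressKBmAt (toSite r) Lc (KInvStep (d := 3) Lc l))) Lc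
              (unitS (sfStep Lc l) (smStep 3 Lc l) (SpureRecAt 3 Lc (toSite r) cE cVH cΛ l)) (unitM (sfStep Lc l) (smStep 3 Lc l) (M1At 3 Lc (toSite r) cΛ l)) 0
              (unitM₂ (sfStep Lc l) (smStep 3 Lc l) (M2Of 3 Lc (mixFFAt (toSite r) Lc) l))) κ u κ' u') + cB • vh₂S κ u κ' u')
          + (1 : ℝ) • fun κ u κ' u' => sgnK (trK ((fun κ u κ' u' => (cE₂ * (Lc : ℝ) ^ (2 * (3 + 1))) • mmRead Lc (K3OfK
            (unitK (sfStep Lc l) (smStep 3 Lc l) (coDressKBmAt (toSite r) Lc (KInvStep (d := 3) Lc l))) Lc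
            (unitS (sfStep Lc l) (smStep 3 Lc l) (SpureRecAt 3 Lc (toSite r) cE cVH cΛ l)) (unitM (sfStep Lc l) (smStep 3 Lc l) (M1At 3 Lc (toSite r) cΛ l))
            (W2SymOfK (unitK (sfStep Lc l) (smStep 3 Lc l) (coDressKBmAt (toSite r) Lc (KInvStep (d := 3) Lc l))) Lc
              (unitS (sfStep Lc l) (smStep 3 Lc l) (SpureRecAt 3 Lc (toSite r) cE cVH cΛ l)) (unitM (sfStep Lc l) (smStep 3 Lc l) (M1At 3 Lc (toSite r) cΛ l)) 0
              (unitM₂ (sfStep Lc l) (smStep 3 Lc l) (M2Of 3 Lc (mixFFAt (toSite r) Lc) l))) κ u κ' u') + cB • vh₂S κ u κ' u') κ u κ' u'))))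
        + (lin4 (cE₂ * (Lc : ℝ) ^ (2 * (3 + 1))) (unitK (sfStep Lc l) (smStep 3 Lc l) (coDressKBmAt (toSite r) Lc (KInvStep (d := 3) Lc l))) Lc
              ((1 / 2 : ℝ) • (unitS₂ (sfStep Lc l) (smStep 3 Lc l) (T2RecAt 3 Lc (toSite r) cE cVH cΛ cE₂ cB Tc vh₂S (mixFFAt (toSite r) Lc) l)
          + (1 : ℝ) • fun κ u κ' u' => sgnK (trK (unitS₂ (sfStep Lc l) (smStep 3 Lc l) (T2RecAt 3 Lc (toSite r) cE cVH cΛ cE₂ cB Tc vh₂S (mixFFAt (toSite r) Lc) l) κ u κ' u'))))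
          - lin4 (cE₂ * (Lc : ℝ) ^ (2 * (3 + 1))) (unitK (sfStep Lc l) (smStep 3 Lc l) (KInvStep (d := 3) Lc l)) Lc
              ((1 / 2 : ℝ) • (unitS₂ (sfStep Lc l) (smStep 3 Lc l) (T2RecAt 3 Lc (toSite r) cE cVH cΛ cE₂ cB Tc vh₂S (mixFFAt (toSite r) Lc) l)
          + (1 : ℝ) • fun κ u κ' u' => sgnK (trK (unitS₂ (sfStep Lc l) (smStep 3 Lc l) (T2RecAt 3 Lc (toSite r) cE cVH cΛ cE₂ cB Tc vh₂S (mixFFAt (toSite r) Lc) l) κ u κ' u')))))) κ κ' (Sum.inl κ₁) (Sum.inl κ₂)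
      + zmode Lc (((1 / 2 : ℝ) • ((fun κ u κ' u' => (cE₂ * (Lc : ℝ) ^ (2 * (3 + 1))) • mmRead Lc (K3OfK
            (unitK (sfStep Lc l) (smStep 3 Lc l) (coDressKBmAt (toSite r) Lc (KInvStep (d := 3) Lc l))) Lc
            (unitS (sfStep Lc l) (smStep 3 Lc l) (SpureRecAt 3 Lc (toSite r) cE cVH cΛ l)) (unitM (sfStep Lc l) (smStep 3 Lc l) (M1At 3 Lc (toSite r) cΛ l))
            (W2SymOfK (unitK (sfStep Lc l) (smStep 3 Lc l) (coDressKBmAt (toSite r) Lc (KInvStep (d := 3) Lc l))) Lc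
              (unitS (sfStep Lc l) (smStep 3 Lc l) (SpureRecAt 3 Lc (toSite r) cE cVH cΛ l)) (unitM (sfStep Lc l) (smStep 3 Lc l) (M1At 3 Lc (toSite r) cΛ l)) 0
              (unitM₂ (sfStep Lc l) (smStep 3 Lc l) (M2Of 3 Lc (mixFFAt (toSite r) Lc) l))) κ u κ' u') + cB • vh₂S κ u κ' u')
          + (1 : ℝ) • fun κ u κ' u' => sgnK (trK ((fun κ u κ' u' => (cE₂ * (Lc : ℝ) ^ (2 * (3 + 1))) • mmRead Lc (K3OfK
            (unitK (sfStep Lc l) (smStep 3 Lc l) (coDressKBmAt (toSite r) Lc (KInvStep (d := 3) Lc l))) Lc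
            (unitS (sfStep Lc l) (smStep 3 Lc l) (SpureRecAt 3 Lc (toSite r) cE cVH cΛ l)) (unitM (sfStep Lc l) (smStep 3 Lc l) (M1At 3 Lc (toSite r) cΛ l))
            (W2SymOfK (unitK (sfStep Lc l) (smStep 3 Lc l) (coDressKBmAt (toSite r) Lc (KInvStep (d := 3) Lc l))) Lc
              (unitS (sfStep Lc l) (smStep 3 Lc l) (SpureRecAt 3 Lc (toSite r) cE cVH cΛ l)) (unitM (sfStep Lc l) (smStep 3 Lc l) (M1At 3 Lc (toSite r) cΛ l)) 0
              (unitM₂ (sfStep Lc l) (smStep 3 Lc l) (M2Of 3 Lc (mixFFAt (toSite r) Lc) l))) κ u κ' u') + cB • vh₂S κ u κ' u') κ u κ' u'))))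
        + (lin4 (cE₂ * (Lc : ℝ) ^ (2 * (3 + 1))) (unitK (sfStep Lc l) (smStep 3 Lc l) (coDressKBmAt (toSite r) Lc (KInvStep (d := 3) Lc l))) Lc
              ((1 / 2 : ℝ) • (unitS₂ (sfStep Lc l) (smStep 3 Lc l) (T2RecAt 3 Lc (toSite r) cE cVH cΛ cE₂ cB Tc vh₂S (mixFFAt (toSite r) Lc) l)
          + (1 : ℝ) • fun κ u κ' u' => sgnK (trK (unitS₂ (sfStep Lc l) (smStep 3 Lc l) (T2RecAt 3 Lc (toSite r) cE cVH cΛ cE₂ cB Tc vh₂S (mixFFAt (toSite r) Lc) l) κ u κ' u'))))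
          - lin4 (cE₂ * (Lc : ℝ) ^ (2 * (3 + 1))) (unitK (sfStep Lc l) (smStep 3 Lc l) (KInvStep (d := 3) Lc l)) Lc
              ((1 / 2 : ℝ) • (unitS₂ (sfStep Lc l) (smStep 3 Lc l) (T2RecAt 3 Lc (toSite r) cE cVH cΛ cE₂ cB Tc vh₂S (mixFFAt (toSite r) Lc) l)
          + (1 : ℝ) • fun κ u κ' u' => sgnK (trK (unitS₂ (sfStep Lc l) (smStep 3 Lc l) (T2RecAt 3 Lc (toSite r) cE cVH cΛ cE₂ cB Tc vh₂S (mixFFAt (toSite r) Lc) l) κ u κ' u')))))) κ' κ (Sum.inl κ₁) (Sum.inl κ₂) = 0 :=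
  zsym_relSource_even_of_rowCLegSym (d := 3) (le_trans (by norm_num) hLc) hr cE cVH cΛ cE₂ cB Tc hBff hBmm ⟨CB, δB, hδB, hB⟩
    (rowCLegSym_of_CSymLeg_three hLc hr cE cVH cΛ cE₂ cB Tc hBff hBmm hB hδB hBt hcE₂ hS₂) l κ κ' κ₁ κ₂

end Summit.QuantumFields.BalabanUV.Beta.GAN24.RowCChargeFormsLegSym
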